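import Summits.ResolutionOfSingularities.ResolutionOfSingularities.Theorems.HilbertSamuelEliminationSigmaMaxModificationsCorridor3WLadderGradeZero
import HarnessLib

/-!
# [OURS · L1 W4.2] THE DEGENERATE VALUE `ν = Φ^{(N)}`: no infinite near chain, no genuine step, from a maximal origin
# (crux `SigmaMaxModifications` stmt-ResolutionOfSingularities-18506; conjunct `SigmaMaxModificationsCorridor3` stmt-…-19249;
# line `w_ladder` v6; plan-1 RULINGS v3.9-1 (R3): «ONE shared fact-free lemma, owner res-L1-w42-stub-1, all-G form»)

Stub worker res-L1-w42-stub-1 (gen 3). Helper file `--supports stmt-ResolutionOfSingularities-19249 --as helper`; kernel only, no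
named fact, no new definition.

THE POINT. Every row functional of the line (`Moving.MaxOriginNoMovingNearChainAtQ`, `…RecurrentNearChainAtQ`,
`Helpers.ClosedOriginNoNearChainAtQ`, W-mono `Helpers.ClosedOriginGeomDirDimNonincrease`) quantifies over ALL values `ν` with
`IsMaximalOrigin p N ν X x`, including the REGULAR VALUE `ν = Φ^{(N)}` (`iterPSum N Phi`, the Hilbert–Samuel function of a regular
point, CJS Lemma 2.31), whereas the tree's bookkeeping (`stateGood_init_general`, `isCanonicalStep_cycle_package`, hence
`StateGood.isPermissible` and every printed-fact socket) needs `ν ≠ Φ^{(N)}`. This file disposes of the regular value ONCE: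

* `IsMaximalOrigin.hsFun_eq_of_eq_iterPSum` — if `Φ^{(N)}` is a MAXIMAL value of `H^N_X` then `H^N_X ≡ Φ^{(N)}` (it is also the
  least value, tree `Scheme.iterPSum_Phi_le_hsFun`): `X(ν) = X` and `X` is regular at every point (`Scheme.hsFun_eq_iterPSum_Phi_iff`).
* THE FIRST CYCLE of `S(X, ν)` then runs on `T = V(vanishingIdeal X) = X` itself (Mathlib `vanishingIdeal_top`, `nilradical_eq_bot`):
  an ADMISSIBLE oracle names a sequence `t` on the regular `T` all of whose centres lie over the non-regular locus `∅`, i.e. have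
  EMPTY support, i.e. are the unit ideal (`support_eq_bot_iff`); the replayed centres `C = ⊤.map ι = ⊤` (`map_top`) give blow-ups which
  are ISOMORPHISMS (`IsBlowup.isIso`, `isEffectiveCartier_top`) — WAITING steps, finitely many (`t` is a finite list) — and the cycle ENDS
  by blowing up the whole label-`0` part `= X_n` with its reduced structure, i.e. the ZERO ideal, whose blow-up has NO point over the
  marked point (stub-2's `IsBlowup.stalkIdeal_base_ne_bot`). The invariant carried along the chain (explicit conjunction): the stage is
  reduced, `H^N ≡ ν` on it, every irreducible component of the stratum has label `0`, and a pending replay has label `0` and remaining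
  centres of empty support.
* `IsMaximalOrigin.noNearChainFrom_of_eq_iterPSum` — **(Φ-a) all-G form: NO INFINITE chain of canonical near steps from a maximal
  origin with `ν = Φ^{(N)}`, for EVERY admissible oracle (functional or not: along ONE chain the pending list shrinks).** Hence every
  `NoNearChainFrom` / `NoMovingNearChainFrom` / recurrent row holds at the regular value for free (`…_of_ne_iterPSum` reductions below).
* `IsMaximalOrigin.not_isBlownUp_of_eq_iterPSum` — **(Φ-b) for a FUNCTIONAL admissible oracle no GENUINE step from a reached stage is
  followed by a near point** (the centre of a step that has a successor is the unit ideal); so W-mono at the regular value is the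
  waiting-step equality of `ē`, and `Helpers.ClosedOriginGeomDirDimNonincrease` reduces to genuine steps at `ν ≠ Φ^{(N)}`
  (`Helpers.closedOriginGeomDirDimNonincrease_of_genuine_of_ne`).

CAVEAT (res-type-066, 05:44:52Z): waiting steps DO exist at the regular value (an admissible oracle may answer `t = [⊤, …, ⊤]` on the
regular `T`), so «no canonical near step at all» is false; the statements here are «no infinite chain» / «no genuine step with a
successor». OURS bookkeeping over the tree's rendering of CJS Rem. 6.29 (1); NOT a statement of the manuscript [Hironaka2017] nor of
[CossartJannsenSaito2020]. AI-written; AI review is weaker than expert review.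

References: V. Cossart, U. Jannsen, S. Saito, LNM 2270 (2020), Lemma 2.31, Rem. 2.32, Rem. 6.29 (1), p. 92 [CossartJannsenSaito2020];
U. Görtz, T. Wedhorn, *Algebraic Geometry I* (2nd ed.), Def. 13.90, Prop. 13.91 [GortzWedhorn2020]. -/

noncomputable section

set_option linter.dupNamespace false -- mandated namespace of this single-conjunct summit

open CategoryTheory AlgebraicGeometry TopologicalSpace Topology

namespace Summit.ResolutionOfSingularities.ResolutionOfSingularities.Theorems

namespace CampaignW42

open Literature.AlgebraicGeometry.Resolution Literature.RingTheory.HilbertSamuel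
open Summit.ResolutionOfSingularities.ResolutionOfSingularities.Theorems.SigmaMaxModificationsCorridor3

universe u

variable {p : ℕ} {R : ∀ S : Scheme.{u}, CentreSeq S → Prop} {N : ℕ} {ν : ℕ → ℕ}

/-! ## §1. A maximal regular value: `H^N ≡ Φ^{(N)}` and every point is regular -/

/-- **If `Φ^{(N)}` is a maximal value of `H^N_X` then `H^N_X ≡ Φ^{(N)}`** (it is the least value of `H^N` at every point of a
locally noetherian scheme, CJS Rem. 2.32 / tree `Scheme.iterPSum_Phi_le_hsFun`). [cite: CossartJannsenSaito2020, Rem. 2.32] -/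
theorem hsFun_eq_of_maximal_iterPSum {X : Scheme.{u}} [IsLocallyNoetherian X]
    (hmax : Maximal (· ∈ Scheme.hsValues X N) (iterPSum N Phi)) (w : X) : Scheme.hsFun X N w = iterPSum N Phi :=
  le_antisymm (hmax.2 ⟨w, rfl⟩ (Scheme.iterPSum_Phi_le_hsFun N w)) (Scheme.iterPSum_Phi_le_hsFun N w)

/-- At a maximal origin with the regular value `ν = Φ^{(N)}`, `H^N ≡ ν` on `X`. [cite: CossartJannsenSaito2020, Rem. 2.32] -/
theorem IsMaximalOrigin.hsFun_eq_of_eq_iterPSum {X : Scheme.{u}} [IsLocallyNoetherian X] {x : X}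
    (hX : IsMaximalOrigin p N ν X x) (hν : ν = iterPSum N Phi) (w : X) : Scheme.hsFun X N w = ν := by
  subst hν
  exact hsFun_eq_of_maximal_iterPSum hX.maximal w

/-- If `H^N ≡ Φ^{(N)}` on `W` then every point of `W` is a regular point (CJS Lemma 2.31, tree `Scheme.hsFun_eq_iterPSum_Phi_iff`).
[cite: CossartJannsenSaito2020, Lemma 2.31] -/
theorem mem_regularLocus_of_hsFun_eq_iterPSum {W : Scheme.{u}} [IsLocallyNoetherian W]
    (h : ∀ w : W, Scheme.hsFun W N w = iterPSum N Phi) (w : W) : w ∈ Scheme.regularLocus W :=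
  ((Scheme.hsFun_eq_iterPSum_Phi_iff N w).mp (h w)).1

/-- If `H^N ≡ ν` on `W` then the `ν`-stratum is everything. [folklore] -/
theorem hsStratum_eq_univ_of_hsFun_eq {W : Scheme.{u}} (h : ∀ w : W, Scheme.hsFun W N w = ν) :
    Scheme.hsStratum W N ν = Set.univ :=
  Set.eq_univ_of_forall fun w => Scheme.mem_hsStratum_iff.mpr (h w)

/-! ## §2. Small tools: unit and zero ideal sheaves, parts with all labels `0`, components under homeomorphisms -/

/-- An ideal sheaf with empty support is the unit ideal sheaf. [folklore] -/
theorem idealSheafData_eq_top_of_support_subset_empty {W : Scheme.{u}} {D : W.IdealSheafData}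
    (h : (D.support : Set W) ⊆ ∅) : D = ⊤ := by
  rw [← Scheme.IdealSheafData.support_eq_bot_iff]
  exact le_bot_iff.mp fun w hw => h hw

/-- On a reduced scheme the vanishing ideal sheaf of a closed set which is everything is the zero ideal sheaf (Mathlib
`vanishingIdeal_top`, `nilradical_eq_bot`). [folklore] -/
theorem vanishingIdeal_eq_bot_of_coe_eq_univ {W : Scheme.{u}} [IsReduced W] (Z : Closeds W) (hZ : (Z : Set W) = Set.univ) :
    Scheme.IdealSheafData.vanishingIdeal Z = ⊥ := by
  have : Z = ⊤ := SetLike.coe_injective (by rw [hZ]; rfl)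
  rw [this, Scheme.IdealSheafData.vanishingIdeal_top, Scheme.nilradical_eq_bot]

/-- **No point of a blow-up lies over a point where the centre is the ZERO ideal**: if `π : X' → X` is a blow-up of `C` and the stalk
`C_{π x'} = 0` then `False` (stub-2's `IsBlowup.stalkIdeal_base_ne_bot`); in particular the blow-up of the zero ideal sheaf has no
points. [folklore] -/
theorem IsBlowup.false_of_eq_bot {X' X : Scheme.{u}} {π : X' ⟶ X} {C : X.IdealSheafData} (hπ : IsBlowup π C) (hC : C = ⊥)
    (x' : X') : False := by
  subst hC
  refine hπ.stalkIdeal_base_ne_bot x' ?_ -- the stalks of the zero ideal sheaf vanish (cf. `stalkIdeal_bot`)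
  obtain ⟨U, hU, hxU, -⟩ := exists_isAffineOpen_mem_and_subset (X := X) (x := π.base x') (U := ⊤) (Opens.mem_top _)
  rw [stalkIdeal_eq_map_germ ⊥ ⟨U, hU⟩ hxU, Scheme.IdealSheafData.ideal_bot, Pi.bot_apply, Ideal.map_bot]

/-- If every irreducible component of `Y` has label `0`, the label-`0` part of `Y` is all of `Y`. [cite: CossartJannsenSaito2020, Rem. 6.29 (1), (6.5)] -/
theorem Labelling.part_zero_eq_of_forall_label {W : Scheme.{u}} (L : Labelling W) {Y : Set W}
    (h : ∀ E ∈ componentsIn Y, L.label E = 0) : L.part Y 0 = Y := by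
  refine Set.Subset.antisymm (L.part_subset Y 0) fun w hw => ?_
  obtain ⟨E, hE, hwE⟩ := componentsIn.exists_mem hw
  exact (L.mem_part_iff Y 0 w).mpr ⟨E, hE, h E hE, hwE⟩

/-- The image of an irreducible component of the whole space under a homeomorphism is an irreducible component of the whole space
(maximal irreducible subsets are transported). [folklore] -/
theorem image_mem_componentsIn_univ_of_homeomorph {A B : Type u} [TopologicalSpace A] [TopologicalSpace B] (e : A ≃ₜ B)
    {E : Set A} (hE : E ∈ componentsIn (Set.univ : Set A)) : e '' E ∈ componentsIn (Set.univ : Set B) := by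
  rw [mem_componentsIn_iff] at hE ⊢
  obtain ⟨-, hirr, hmax⟩ := hE
  refine ⟨Set.subset_univ _, hirr.image e e.continuous.continuousOn, fun T _ hT hET => ?_⟩
  have h1 : E ⊆ e.symm '' T := by
    intro a ha
    exact ⟨e a, hET ⟨a, ha, rfl⟩, e.symm_apply_apply a⟩
  have h2 : e.symm '' T ⊆ E := hmax (e.symm '' T) (Set.subset_univ _) (hT.image e.symm e.symm.continuous.continuousOn) h1
  intro b hb
  refine ⟨e.symm b, h2 ⟨b, hb, rfl⟩, e.apply_symm_apply b⟩

/-! ## §3. The invariant of the first (and only) resolution cycle at the regular value -/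

/-- **ONE STEP AT THE REGULAR VALUE.** Let `ν` be a value with `H^N ≡ ν` on the (reduced) stage `X_n = s.W`, all irreducible components
of `X_n(ν) = X_n` labelled `0`, and — if a cycle is pending — pending label `0` with remaining centres of EMPTY support; let `R` be
admissible. Then along any canonical near step `s → s'`: the step is a REPLAY step (the cycle-ending step, blowing up the zero
ideal, has no point over the marked point), its centre is the UNIT ideal, the blow-down map is an ISOMORPHISM, the same invariant
holds at `s'`, a cycle is pending at `s'`, and the pending list got SHORTER if one was pending at `s`.
[cite: CossartJannsenSaito2020, Rem. 6.29 (1), p. 92] -/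
theorem CanonicalNearStep.regularValue_step (hRa : OracleAdmissible R) {s s' : MarkedStage.{u}}
    (h : CanonicalNearStep R N ν s s') (hred : IsReduced s.W) (hH : ∀ w : s.W, Scheme.hsFun s.W N w = ν)
    (hν : ν = iterPSum N Phi) (hlab : ∀ E ∈ componentsIn (Scheme.hsStratum s.W N ν), s.L.label E = 0)
    (hpend : ∀ Q, s.P = some Q → Q.lbl = 0 ∧ Q.rest.CentresOver ∅) :
    IsReduced s'.W ∧ (∀ w : s'.W, Scheme.hsFun s'.W N w = ν) ∧
      (∀ E ∈ componentsIn (Scheme.hsStratum s'.W N ν), s'.L.label E = 0) ∧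
      (∃ Q', s'.P = some Q' ∧ Q'.lbl = 0 ∧ Q'.rest.CentresOver ∅ ∧
        ∀ Q, s.P = some Q → Q'.rest.length < Q.rest.length) := by
  haveI : IsLocallyNoetherian s.W := s.ln
  haveI := hred
  obtain ⟨C, P', hln, x', hst, hπ, -, -, rfl⟩ := h
  haveI : IsLocallyNoetherian (blowup C) := hln
  have hY : Scheme.hsStratum s.W N ν = Set.univ := hsStratum_eq_univ_of_hsFun_eq hH
  have hpart : s.L.part (Scheme.hsStratum s.W N ν) 0 = Set.univ := by
    rw [Labelling.part_zero_eq_of_forall_label s.L hlab, hY]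
  -- the cycle-ending centre would be the zero ideal: impossible under `x'`
  have hend : ∀ (hcl : IsClosed (s.L.part (Scheme.hsStratum s.W N ν) 0)),
      C = Scheme.IdealSheafData.vanishingIdeal ⟨s.L.part (Scheme.hsStratum s.W N ν) 0, hcl⟩ → False := by
    intro hcl hC
    refine IsBlowup.false_of_eq_bot (blowup.isBlowup C) ?_ x'
    rw [hC]
    exact vanishingIdeal_eq_bot_of_coe_eq_univ _ hpart
  -- a replay centre of empty support is the unit ideal: the step is an isomorphism and the invariant passes
  have hreplay : ∀ {S : Scheme.{u}} (φ : S ⟶ s.W) (D : S.IdealSheafData) (t' : CentreSeq (blowup D)),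
      (D.support : Set S) ⊆ ∅ → t'.CentresOver (blowup.π D ⁻¹' ∅) → C = D.map φ →
      (∃ (φ' : blowup D ⟶ blowup C) (hφ' : IsClosedImmersion φ'),
        φ' ≫ blowup.π C = blowup.π D ≫ φ ∧ P' = some ⟨0, blowup D, φ', hφ', t'⟩) →
      IsReduced (blowup C) ∧ (∀ w : ↥(blowup C), Scheme.hsFun (blowup C) N w = ν) ∧
        (∀ E ∈ componentsIn (Scheme.hsStratum (blowup C) N ν),
          (s.L.next (Scheme.hsStratum s.W N ν) C).label E = 0) ∧
        ∃ Q', P' = some Q' ∧ Q'.lbl = 0 ∧ Q'.rest.CentresOver ∅ ∧ Q'.rest.length = t'.length := by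
    intro S φ D t' hD ht' hC hP
    obtain ⟨φ', hφ', -, rfl⟩ := hP
    have hDtop : D = ⊤ := idealSheafData_eq_top_of_support_subset_empty hD
    have hCtop : C = ⊤ := by rw [hC, hDtop, Scheme.IdealSheafData.map_top]
    haveI : IsIso (blowup.π C) := (blowup.isBlowup C).isIso (by rw [hCtop]; exact isEffectiveCartier_top)
    have hH' : ∀ w : ↥(blowup C), Scheme.hsFun (blowup C) N w = ν := fun w => by
      rw [Scheme.hsFun_eq_of_isOpenImmersion (blowup.π C) N w]; exact hH _
    refine ⟨isReduced_of_isOpenImmersion (blowup.π C), hH', ?_, ⟨0, blowup D, φ', hφ', t'⟩, rfl, rfl, ?_, rfl⟩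
    · intro E hE
      have hY' : Scheme.hsStratum (blowup C) N ν = Set.univ := hsStratum_eq_univ_of_hsFun_eq hH'
      rw [hY'] at hE
      let e : ↥(blowup C) ≃ₜ ↥s.W := Scheme.homeoOfIso (asIso (blowup.π C))
      have himg : (blowup.π C).base '' E ∈ componentsIn (Set.univ : Set s.W) :=
        image_mem_componentsIn_univ_of_homeomorph e hE
      have hcl : IsClosed ((blowup.π C).base '' E) := componentsIn.isClosed isClosed_univ himg
      have hmem : closure ((blowup.π C).base '' E) ∈ componentsIn (Scheme.hsStratum s.W N ν) := by
        rw [hcl.closure_eq, hY]; exact himg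
      rw [Labelling.next_label_of_mem _ _ hmem, hcl.closure_eq]
      exact hlab _ (hY ▸ himg)
    · simpa using ht'
  cases hP : s.P with
  | none =>
    rw [hP] at hst
    obtain ⟨j, hj, hcl, t, hRt, hrep⟩ := hst
    -- the least non-empty label is `0`
    have hj0 : j = 0 := by
      have h0 : (0 : ℕ) ∈ {i | (s.L.part (Scheme.hsStratum s.W N ν) i).Nonempty} := by
        show (s.L.part (Scheme.hsStratum s.W N ν) 0).Nonempty
        rw [hpart]; exact ⟨s.pt, trivial⟩
      exact Nat.le_zero.mp (hj.2 h0)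
    subst hj0
    -- the replayed subscheme is `X_n` itself (zero vanishing ideal), regular: the oracle's centres have empty support
    have hI : Scheme.IdealSheafData.vanishingIdeal ⟨s.L.part (Scheme.hsStratum s.W N ν) 0, hcl⟩ = ⊥ :=
      vanishingIdeal_eq_bot_of_coe_eq_univ _ hpart
    obtain ⟨-, hover, -⟩ := hRa _ t hRt
    have hreg : Scheme.regularLocus
        (Scheme.IdealSheafData.vanishingIdeal ⟨s.L.part (Scheme.hsStratum s.W N ν) 0, hcl⟩).subscheme = Set.univ := by
      haveI : IsIso (Scheme.IdealSheafData.vanishingIdeal ⟨s.L.part (Scheme.hsStratum s.W N ν) 0, hcl⟩).subschemeι :=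
        (Scheme.isIso_subschemeι_iff_eq_bot _).mpr hI
      refine Set.eq_univ_of_forall fun y => ?_
      rw [mem_regularLocus_iff_of_flat_of_isPreimmersion
        (Scheme.IdealSheafData.vanishingIdeal ⟨s.L.part (Scheme.hsStratum s.W N ν) 0, hcl⟩).subschemeι y]
      exact mem_regularLocus_of_hsFun_eq_iterPSum (fun w => (hH w).trans hν) _
    rw [hreg, Set.compl_univ] at hover
    cases t with
    | nil _ =>
      obtain ⟨⟨hcl', hC⟩, -⟩ := hrep
      exact (hend hcl' hC).elim
    | cons D t' =>
      obtain ⟨hD, ht'⟩ := (CentreSeq.centresOver_cons D t' ∅).mp hover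
      obtain ⟨hC, hP'⟩ := hrep
      obtain ⟨h1, h2, h3, Q', hQ', hl, hr, -⟩ := hreplay _ D t' hD ht' hC hP'
      exact ⟨h1, h2, h3, Q', hQ', hl, hr, fun Q hQ => absurd hQ (by simp)⟩
  | some Q =>
    rw [hP] at hst
    obtain ⟨-, hrep⟩ := hst
    obtain ⟨hlbl, hover⟩ := hpend Q hP
    haveI := Q.isClosedImmersion
    -- split on the remaining centres of the pending replay
    obtain ⟨lbl, S, φ, hφ, rest⟩ := Q
    simp only at hlbl hover hrep
    subst hlbl
    cases rest with
    | nil _ =>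
      obtain ⟨⟨hcl', hC⟩, -⟩ := hrep
      exact (hend hcl' hC).elim
    | cons D t' =>
      obtain ⟨hD, ht'⟩ := (CentreSeq.centresOver_cons D t' ∅).mp hover
      obtain ⟨hC, hP'⟩ := hrep
      obtain ⟨h1, h2, h3, Q', hQ', hl, hr, hlen⟩ := hreplay φ D t' hD ht' hC hP'
      refine ⟨h1, h2, h3, Q', hQ', hl, hr, fun Q hQ => ?_⟩
      obtain rfl := Option.some_injective _ hQ
      simp [hlen]

/-- **THE INVARIANT ALONG `Reaches` from a maximal origin with `ν = Φ^{(N)}`** (admissible oracle): every reached stage is reduced,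
has `H^N ≡ ν`, all irreducible components of its stratum labelled `0`, and a pending replay (if any) of label `0` with remaining
centres of empty support. [cite: CossartJannsenSaito2020, Rem. 6.29 (1)] -/
theorem IsMaximalOrigin.regularValue_invariant (hRa : OracleAdmissible R) {X : Scheme.{u}} [IsLocallyNoetherian X] {x : X}
    (hX : IsMaximalOrigin p N ν X x) (hν : ν = iterPSum N Phi) {s : MarkedStage.{u}}
    (hs : Reaches R N ν (MarkedStage.init X x) s) :
    IsReduced s.W ∧ (∀ w : s.W, Scheme.hsFun s.W N w = ν) ∧
      (∀ E ∈ componentsIn (Scheme.hsStratum s.W N ν), s.L.label E = 0) ∧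
      (∀ Q, s.P = some Q → Q.lbl = 0 ∧ Q.rest.CentresOver ∅) := by
  induction hs with
  | refl =>
    exact ⟨hX.isReduced, hX.hsFun_eq_of_eq_iterPSum hν, fun _ _ => rfl, fun Q hQ => absurd hQ (by simp [MarkedStage.init])⟩
  | tail _ hlast ih =>
    obtain ⟨hred, hH, hlab, hpend⟩ := ih
    obtain ⟨h1, h2, h3, Q', hQ', hl, hr, -⟩ := hlast.regularValue_step hRa hred hH hν hlab hpend
    refine ⟨h1, h2, h3, fun Q hQ => ?_⟩
    rw [hQ'] at hQ
    obtain rfl := Option.some_injective _ hQ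
    exact ⟨hl, hr⟩

/-! ## §4. (Φ-a) No infinite near chain at the regular value — all grades, every admissible oracle -/

/-- **(Φ-a) NO INFINITE NEAR CHAIN FROM A MAXIMAL ORIGIN WITH THE REGULAR VALUE `ν = Φ^{(N)}`**, in every grade `G` and for every
ADMISSIBLE oracle (functional or not): along a chain of canonical near steps the pending replay list is non-empty from the second
stage on and gets strictly shorter at every step. [cite: CossartJannsenSaito2020, Rem. 6.29 (1), Lemma 2.31] -/
theorem IsMaximalOrigin.noNearChainFrom_of_eq_iterPSum (hRa : OracleAdmissible R) {X : Scheme.{u}} [IsLocallyNoetherian X]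
    {x : X} (hX : IsMaximalOrigin p N ν X x) (hν : ν = iterPSum N Phi) (G : MarkedStage.{u} → Prop) :
    NoNearChainFrom R N ν (MarkedStage.init X x) G := by
  rintro ⟨c, h0, hstep, -⟩
  -- the invariant holds along the chain
  have hinv : ∀ n, IsReduced (c n).W ∧ (∀ w : (c n).W, Scheme.hsFun (c n).W N w = ν) ∧
      (∀ E ∈ componentsIn (Scheme.hsStratum (c n).W N ν), (c n).L.label E = 0) ∧
      (∀ Q, (c n).P = some Q → Q.lbl = 0 ∧ Q.rest.CentresOver ∅) :=
    fun n => hX.regularValue_invariant hRa hν (reaches_chain h0 hstep n)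
  -- from stage 1 on a replay is pending; its length strictly decreases
  have hsome : ∀ n, ∃ Q', (c (n + 1)).P = some Q' ∧ ∀ Q, (c n).P = some Q → Q'.rest.length < Q.rest.length := by
    intro n
    obtain ⟨hred, hH, hlab, hpend⟩ := hinv n
    obtain ⟨-, -, -, Q', hQ', -, -, hlt⟩ := (hstep n).regularValue_step hRa hred hH hν hlab hpend
    exact ⟨Q', hQ', hlt⟩
  -- the measure `f n = length of the pending list at stage n + 1`
  have hf : ∀ n, ∃ Q', (c (n + 1)).P = some Q' ∧ ∀ m, ∃ Q'', (c (n + 1 + m)).P = some Q'' ∧ Q''.rest.length + m ≤ Q'.rest.length := by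
    intro n
    obtain ⟨Q', hQ', -⟩ := hsome n
    refine ⟨Q', hQ', fun m => ?_⟩
    induction m with
    | zero => exact ⟨Q', by simpa using hQ', by simp⟩
    | succ m ih =>
      obtain ⟨Q'', hQ'', hle⟩ := ih
      obtain ⟨Q''', hQ''', hlt⟩ := hsome (n + 1 + m)
      refine ⟨Q''', hQ''', ?_⟩
      have := hlt Q'' hQ''
      omega
  obtain ⟨Q₁, hQ₁, hbound⟩ := hf 0
  obtain ⟨Q'', -, hle⟩ := hbound (Q₁.rest.length + 1)
  omega

/-- (Φ-a), moving form: no MOVING chain from a maximal origin with `ν = Φ^{(N)}`. [folklore] -/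
theorem IsMaximalOrigin.noMovingNearChainFrom_of_eq_iterPSum (hRa : OracleAdmissible R) {X : Scheme.{u}}
    [IsLocallyNoetherian X] {x : X} (hX : IsMaximalOrigin p N ν X x) (hν : ν = iterPSum N Phi)
    (G : MarkedStage.{u} → Prop) : NoMovingNearChainFrom R N ν (MarkedStage.init X x) G :=
  (hX.noNearChainFrom_of_eq_iterPSum hRa hν G).noMoving

/-- (Φ-a) from any REACHED stage: no infinite near chain from a stage reached from a maximal origin with `ν = Φ^{(N)}`.
[folklore] -/
theorem IsMaximalOrigin.noNearChainFrom_of_reaches_of_eq_iterPSum (hRa : OracleAdmissible R) {X : Scheme.{u}}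
    [IsLocallyNoetherian X] {x : X} (hX : IsMaximalOrigin p N ν X x) (hν : ν = iterPSum N Phi) {s : MarkedStage.{u}}
    (hs : Reaches R N ν (MarkedStage.init X x) s) (G : MarkedStage.{u} → Prop) : NoNearChainFrom R N ν s G := by
  rintro ⟨c, h0, hstep, hG⟩
  exact hX.noNearChainFrom_of_eq_iterPSum hRa hν G ⟨c, hs.trans h0, hstep, hG⟩

/-! ## §5. (Φ-b) No genuine step with a successor at the regular value (functional oracle) -/

/-- **(Φ-b) AT THE REGULAR VALUE NO GENUINE STEP HAS A SUCCESSOR**: from a stage reached from a maximal origin with `ν = Φ^{(N)}`, if a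
canonical near step `s → s'` exists then the marked point of `s` is NOT blown up (functional admissible oracle: the centre of the step
is the unit ideal, and it is THE canonical centre). [cite: CossartJannsenSaito2020, Rem. 6.29 (1)] -/
theorem IsMaximalOrigin.not_isBlownUp_of_eq_iterPSum (hRf : OracleFunctional R) (hRa : OracleAdmissible R) {X : Scheme.{u}}
    [IsLocallyNoetherian X] {x : X} (hX : IsMaximalOrigin p N ν X x) (hν : ν = iterPSum N Phi) {s s' : MarkedStage.{u}}
    (hs : Reaches R N ν (MarkedStage.init X x) s) (h : CanonicalNearStep R N ν s s') : ¬ s.IsBlownUp R N ν := by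
  intro hb
  obtain ⟨hred, hH, hlab, hpend⟩ := hX.regularValue_invariant hRa hν hs
  haveI : IsLocallyNoetherian s.W := s.ln
  haveI := hred
  have hY : Scheme.hsStratum s.W N ν = Set.univ := hsStratum_eq_univ_of_hsFun_eq hH
  have hpart : s.L.part (Scheme.hsStratum s.W N ν) 0 = Set.univ := by
    rw [Labelling.part_zero_eq_of_forall_label s.L hlab, hY]
  obtain ⟨C, P', hln, x', hst, hπ, -, -, rfl⟩ := h
  have hmem : s.pt ∈ (C.support : Set s.W) := by
    obtain ⟨C₀, P₀, hst₀, hmem₀⟩ := hb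
    obtain rfl : C₀ = C := hst₀.centre_unique hRf hst
    exact hmem₀
  -- the step's centre is either the zero ideal (no point above) or the unit ideal (empty support)
  have hend : ∀ (hcl : IsClosed (s.L.part (Scheme.hsStratum s.W N ν) 0)),
      C = Scheme.IdealSheafData.vanishingIdeal ⟨s.L.part (Scheme.hsStratum s.W N ν) 0, hcl⟩ → False := by
    intro hcl hC
    refine IsBlowup.false_of_eq_bot (blowup.isBlowup C) ?_ x'
    rw [hC]
    exact vanishingIdeal_eq_bot_of_coe_eq_univ _ hpart
  have hunit : ∀ {S : Scheme.{u}} (φ : S ⟶ s.W) (D : S.IdealSheafData), (D.support : Set S) ⊆ ∅ → C = D.map φ → False := by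
    intro S φ D hD hC
    have hCtop : C = ⊤ := by
      rw [hC, idealSheafData_eq_top_of_support_subset_empty hD, Scheme.IdealSheafData.map_top]
    rw [hCtop, Scheme.IdealSheafData.support_top] at hmem
    exact hmem
  cases hP : s.P with
  | none =>
    rw [hP] at hst
    obtain ⟨j, hj, hcl, t, hRt, hrep⟩ := hst
    have hj0 : j = 0 := by
      have h0 : (0 : ℕ) ∈ {i | (s.L.part (Scheme.hsStratum s.W N ν) i).Nonempty} := by
        show (s.L.part (Scheme.hsStratum s.W N ν) 0).Nonempty
        rw [hpart]; exact ⟨s.pt, trivial⟩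
      exact Nat.le_zero.mp (hj.2 h0)
    subst hj0
    have hI : Scheme.IdealSheafData.vanishingIdeal ⟨s.L.part (Scheme.hsStratum s.W N ν) 0, hcl⟩ = ⊥ :=
      vanishingIdeal_eq_bot_of_coe_eq_univ _ hpart
    obtain ⟨-, hover, -⟩ := hRa _ t hRt
    have hreg : Scheme.regularLocus
        (Scheme.IdealSheafData.vanishingIdeal ⟨s.L.part (Scheme.hsStratum s.W N ν) 0, hcl⟩).subscheme = Set.univ := by
      haveI : IsIso (Scheme.IdealSheafData.vanishingIdeal ⟨s.L.part (Scheme.hsStratum s.W N ν) 0, hcl⟩).subschemeι :=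
        (Scheme.isIso_subschemeι_iff_eq_bot _).mpr hI
      refine Set.eq_univ_of_forall fun y => ?_
      rw [mem_regularLocus_iff_of_flat_of_isPreimmersion
        (Scheme.IdealSheafData.vanishingIdeal ⟨s.L.part (Scheme.hsStratum s.W N ν) 0, hcl⟩).subschemeι y]
      exact mem_regularLocus_of_hsFun_eq_iterPSum (fun w => (hH w).trans hν) _
    rw [hreg, Set.compl_univ] at hover
    cases t with
    | nil _ =>
      obtain ⟨⟨hcl', hC⟩, -⟩ := hrep
      exact hend hcl' hC
    | cons D t' =>
      obtain ⟨hD, -⟩ := (CentreSeq.centresOver_cons D t' ∅).mp hover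
      exact hunit _ D hD hrep.1
  | some Q =>
    rw [hP] at hst
    obtain ⟨-, hrep⟩ := hst
    obtain ⟨hlbl, hover⟩ := hpend Q hP
    obtain ⟨lbl, S, φ, hφ, rest⟩ := Q
    simp only at hlbl hover hrep
    subst hlbl
    cases rest with
    | nil _ =>
      obtain ⟨⟨hcl', hC⟩, -⟩ := hrep
      exact hend hcl' hC
    | cons D t' =>
      obtain ⟨hD, -⟩ := (CentreSeq.centresOver_cons D t' ∅).mp hover
      exact hunit φ D hD hrep.1

end CampaignW42

end Summit.ResolutionOfSingularities.ResolutionOfSingularities.Theorems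

end
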